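import Summits.NavierStokesRegularity.NavierStokesRegularity.Theorems.PerpetualPumpAveragedTypeIBlowupPulseTools
import Mathlib.MeasureTheory.Integral.IntervalIntegral.Basic

/-!
# Crux `PerpetualPump.AveragedTypeIBlowup` (stmt-NavierStokesRegularity-1835), line `Sketch`:
# stub `handoff` — the hand-off invariant of the new front, clause by clause

Fourth tools file of the proof of the registered stub `stub_handoff` (the hand-off certificate of the
window one-step theorem; Mathlib-only mathematics). Pure bookkeeping: given the hand-off invariant
`Inv n B t₀` of the old front, the pre-ignition box `Pre` on `[t₀, t_ι]`, the pulse box `Pul` on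
`[t_ι, t₁]`, and the facts at the argmax time `t₁` of the next carrier produced by the transfer pulse
(`b_{n+1}(t₁) = B'` is a running maximum, the next bond is positive and `≤ Fε̄B'` together with its
majorant, the old front pair sits at `w_n² = q³B' ± 1`, `b_n = 1/2 ± 1/20`), the theorem
`handoff_inv` verifies `Inv (n+1) B' t₁`: the level-`1` pair of the new front is the old level `2`
(`lad 2 = ε̄`), its ladder is the old ladder shifted by one rung (`lad (j+1) ≤ lad j`), its histories
combine the old histories with the ladder clauses of the boxes, and its trail gains the spent previous
pair `n − 1` (entry time `t₁`) while the older trail modes keep their entry records and extend their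
running bounds by the trail clauses of the boxes. The registered tools sub-goal `stub_handoffInv` is
the degenerate-interval remark used for the new trail entry.

Two further real-analysis lemmas serve the strict first crossing of level `1` by the next carrier:
`handoff_crossing` (first passage + a continuous positive derivative at the passage time gives a
strict crossing) and `handoff_w_lower` (before the crossing the old bond has not collapsed:
`w ≥ 9` in the slow time of the pulse, by the energy corridor and `w' ≥ −1/2000`).

## References

T. Tao, *Finite time blowup for an averaged three-dimensional Navier–Stokes equation*, J. Amer.
Math. Soc. 29 (2016), §5–6 (the cascade heuristics); the content here is folklore bookkeeping.
-/

noncomputable section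

-- the summit namespace `…NavierStokesRegularity.NavierStokesRegularity…` is the tree convention
set_option linter.dupNamespace false

open Set MeasureTheory

namespace Summit.NavierStokesRegularity.NavierStokesRegularity.Theorems.PerpetualPumpAveragedTypeIBlowup

/-- A point of the degenerate interval `[a, a]` is `a`. [folklore] -/
theorem handoff_mem_Icc_self {a s : ℝ} (hs : s ∈ Icc a a) : s = a := le_antisymm hs.2 hs.1

/-- **Registered tools sub-goal `stub_handoffInv`** of the stub `handoff` (line `Sketch`, crux
stmt-NavierStokesRegularity-1835): a statement on the degenerate interval `[a, a]` is the statement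
at `a`. [folklore] -/
theorem stub_handoffInv : ∀ (P : ℝ → Prop) (a : ℝ), P a → ∀ s ∈ Icc a a, P s :=
  fun _ _ h _ hs => (handoff_mem_Icc_self hs).symm ▸ h

/-- **The hand-off invariant of the new front.** See the module docstring. [folklore] -/
theorem handoff_inv {ε₀ εb F bhi q B B' t₀ tι t₁ T : ℝ} {n₀ n : ℤ} {bv wv M0 M1 : ℤ → ℝ → ℝ}
    {R : ℤ → ℝ} {lad : ℕ → ℝ} {Inv : ℤ → ℝ → ℝ → Prop} {Pre Pul : ℝ → Prop}
    (hInv : ∀ (m : ℤ) (Bm t : ℝ), Inv m Bm t ↔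
        (bv m t = Bm ∧ (∀ s ∈ Icc 0 t, bv m s ≤ Bm) ∧
        (0 ≤ wv m t ∧ wv m t ≤ F * εb * Bm ∧ M1 m t ≤ F * εb * Bm ∧ M0 m t ≤ 2 * Bm) ∧
        (n₀ ≤ m - 1 → 0 ≤ wv (m - 1) t ∧ q ^ 3 * Bm - 1 ≤ (wv (m - 1) t) ^ 2 ∧
          (wv (m - 1) t) ^ 2 ≤ q ^ 3 * Bm + 1 ∧ 9 / 20 ≤ bv (m - 1) t ∧ bv (m - 1) t ≤ 11 / 20 ∧
          M0 (m - 1) t ≤ 5 * (bhi + 4) ^ 2 ∧ M1 (m - 1) t ≤ 5 * (bhi + 4) ^ 2) ∧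
        (|bv (m + 1) t| ≤ εb ∧ |wv (m + 1) t| ≤ εb ∧ M0 (m + 1) t ≤ εb ∧ M1 (m + 1) t ≤ εb) ∧
        (∀ j : ℕ, 2 ≤ j → |bv (m + j) t| ≤ lad j ∧ |wv (m + j) t| ≤ lad j / 5 ∧
          M0 (m + j) t ≤ lad j ∧ M1 (m + j) t ≤ lad j) ∧
        (∀ j : ℕ, 1 ≤ j → ∀ s ∈ Icc 0 t, bv (m + j) s ≤ 1 / 2) ∧
        (∀ k : ℤ, n₀ ≤ k → k ≤ m - 2 → ∃ te ∈ Icc 0 t,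
          (-(2 / 5) ≤ bv k te ∧ bv k te ≤ 3 / 10 ∧ |wv k te| ≤ 1 / 200 ∧
            M0 k te ≤ 10 * (bhi + 4) ^ 2 ∧ M1 k te ≤ 10 * (bhi + 4) ^ 2) ∧
          ∀ s ∈ Icc te t, -(9 / 20) ≤ bv k s ∧ bv k s ≤ 7 / 20 ∧ |wv k s| ≤ 1 / 100 ∧
            M0 k s ≤ 10 * (bhi + 4) ^ 2 + 1 ∧ M1 k s ≤ 10 * (bhi + 4) ^ 2 + 1 ∧ |wv (k - 1) s| ≤ 1 / 100 ∧
            -(1 / 2) ≤ bv (k + 1) s ∧ bv (k + 1) s ≤ 9 / 10)))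
    (hPre : ∀ s : ℝ, Pre s ↔
        ((B * Real.exp (-(R n * (s - t₀))) - 3 / 2 ≤ bv n s ∧ bv n s ≤ B * Real.exp (-(R n * (s - t₀))) + 5 / 2 ∧
          0 ≤ wv n s ∧ M0 n s ≤ 6 * (B + 3) ∧
          M1 n s ≤ F * εb * B + 2 * wv n s + 2 * εb * (B + 3) ^ 2 * (R n * (s - t₀))) ∧
        (n₀ ≤ n - 1 → -(1 / 100) ≤ wv (n - 1) s ∧ (wv (n - 1) s) ^ 2 ≤ q ^ 3 * B + 2 ∧
          -(2 / 5) ≤ bv (n - 1) s ∧ bv (n - 1) s ≤ 17 / 20 ∧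
          (t₀ + 2 * (100 + 4 * Real.log (bhi + 5)) / (B * R n) ≤ s → |wv (n - 1) s| ≤ 1 / 200 ∧ bv (n - 1) s ≤ 3 / 10) ∧
          M0 (n - 1) s ≤ 6 * (bhi + 4) ^ 2 ∧ M1 (n - 1) s ≤ 6 * (bhi + 4) ^ 2 ∧
          (1 + ε₀) ^ (-(2 : ℤ)) * R n * ∫ u in t₀..s, (wv (n - 1) u) ^ 2 ≤ 9 / 10) ∧
        (|bv (n + 1) s| ≤ εb + q / 100 + 1 / 10 ^ 3 ∧ |wv (n + 1) s| ≤ 11 / 10 * εb ∧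
          M0 (n + 1) s ≤ εb + (B + 3) / 40 ∧ M1 (n + 1) s ≤ 4 * εb) ∧
        (∀ j : ℕ, 2 ≤ j → |bv (n + j) s| ≤ lad j ∧ |wv (n + j) s| ≤ lad j / 5 ∧
          M0 (n + j) s ≤ lad j ∧ M1 (n + j) s ≤ lad j) ∧
        (∀ k : ℤ, n₀ ≤ k → k ≤ n - 2 → -(9 / 20) ≤ bv k s ∧ bv k s ≤ 7 / 20 ∧ |wv k s| ≤ 1 / 100 ∧
          M0 k s ≤ 10 * (bhi + 4) ^ 2 + 1 ∧ M1 k s ≤ 10 * (bhi + 4) ^ 2 + 1)))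
    (hPul : ∀ s : ℝ, Pul s ↔
        ((-(1 / 2) ≤ bv n s ∧ bv n s ≤ bv n tι + 1 / 100 ∧ |wv n s| ≤ bv n tι + 1 / 100 ∧
          -(q / 50) ≤ bv (n + 1) s ∧ bv (n + 1) s ≤ q * (bv n tι + 1 / 100) ∧
          M0 n s ≤ 3 * (bhi + 4) ^ 2 ∧ M1 n s ≤ 5 * (bhi + 4) ^ 2 ∧ M0 (n + 1) s ≤ 3 / 2 * B ∧
          |wv (n + 1) s| ≤ 1 / 10 ^ 3 ∧ M1 (n + 1) s ≤ 1) ∧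
        (n₀ ≤ n - 1 → |wv (n - 1) s| ≤ 1 / 200 ∧ -(2 / 5) ≤ bv (n - 1) s ∧ bv (n - 1) s ≤ 3 / 10 ∧
          M0 (n - 1) s ≤ 6 * (bhi + 4) ^ 2 ∧ M1 (n - 1) s ≤ 6 * (bhi + 4) ^ 2 ∧
          (1 + ε₀) ^ (-(2 : ℤ)) * R n * ∫ u in t₀..s, (wv (n - 1) u) ^ 2 ≤ 9 / 10) ∧
        (∀ j : ℕ, 2 ≤ j → |bv (n + j) s| ≤ lad j ∧ |wv (n + j) s| ≤ lad j / 5 ∧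
          M0 (n + j) s ≤ lad j ∧ M1 (n + j) s ≤ lad j) ∧
        (∀ k : ℤ, n₀ ≤ k → k ≤ n - 2 → -(9 / 20) ≤ bv k s ∧ bv k s ≤ 7 / 20 ∧ |wv k s| ≤ 1 / 100 ∧
          M0 k s ≤ 10 * (bhi + 4) ^ 2 + 1 ∧ M1 k s ≤ 10 * (bhi + 4) ^ 2 + 1)))
    (hlad : (∀ j : ℕ, 0 ≤ lad j ∧ lad j ≤ εb) ∧ lad 2 = εb ∧ ∀ j : ℕ, lad (j + 1) ≤ lad j)
    (hεb : 0 ≤ εb) (hεb1 : εb ≤ 1 / 2) (hq2 : q ≤ 21 / 20) (ht₀ : 0 ≤ t₀) (ht₀ι : t₀ ≤ tι)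
    (hι1 : tι ≤ t₁) (ht₁T : t₁ ≤ T)
    (hvan : ∀ k : ℤ, k < n₀ → ∀ t ∈ Icc 0 T, bv k t = 0 ∧ wv k t = 0 ∧ M0 k t = 0 ∧ M1 k t = 0)
    (hInv0 : Inv n B t₀) (hPreAll : ∀ s ∈ Icc t₀ tι, Pre s) (hPulAll : ∀ s ∈ Icc tι t₁, Pul s)
    (hB'1 : 1 ≤ B') (hbB' : bv (n + 1) t₁ = B') (hβmax : ∀ s ∈ Icc tι t₁, bv (n + 1) s ≤ B')
    (hy0 : 0 ≤ wv (n + 1) t₁) (hy1 : wv (n + 1) t₁ ≤ F * εb * B') (hmy : M1 (n + 1) t₁ ≤ F * εb * B')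
    (hM0x : 3 / 2 * B ≤ 2 * B') (hwn0 : 0 ≤ wv n t₁) (hwn1 : q ^ 3 * B' - 1 ≤ (wv n t₁) ^ 2)
    (hwn2 : (wv n t₁) ^ 2 ≤ q ^ 3 * B' + 1) (hbn1 : 9 / 20 ≤ bv n t₁) (hbn2 : bv n t₁ ≤ 11 / 20) :
    Inv (n + 1) B' t₁ := by
  have ht₀1 : t₀ ≤ t₁ := ht₀ι.trans hι1
  obtain ⟨hlad0, hlad2, hladm⟩ := hlad
  have hP0 : 0 ≤ (bhi + 4) ^ 2 := sq_nonneg _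
  -- the boxes at t₁ and the old invariant
  obtain ⟨⟨-, -, -, -, -, hM0n, hM1n, hM0x1, -, -⟩, hprev1, hlad1, htrail1⟩ :=
    (hPul t₁).1 (hPulAll t₁ ⟨hι1, le_rfl⟩)
  obtain ⟨-, -, -, -, -, -, hhist0, htrail0⟩ := (hInv n B t₀).1 hInv0
  -- uniform consequences of the boxes on [t₀, t₁]
  have hbox : ∀ s ∈ Icc t₀ t₁,
      (∀ j : ℕ, 2 ≤ j → |bv (n + j) s| ≤ lad j) ∧
      (∀ k : ℤ, n₀ ≤ k → k ≤ n - 2 → -(9 / 20) ≤ bv k s ∧ bv k s ≤ 7 / 20 ∧ |wv k s| ≤ 1 / 100 ∧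
        M0 k s ≤ 10 * (bhi + 4) ^ 2 + 1 ∧ M1 k s ≤ 10 * (bhi + 4) ^ 2 + 1) ∧
      (n₀ ≤ n - 1 → -(1 / 2) ≤ bv (n - 1) s ∧ bv (n - 1) s ≤ 9 / 10) := by
    intro s hs
    rcases le_total s tι with h | h
    · obtain ⟨-, hpv, -, hl, htr⟩ := (hPre s).1 (hPreAll s ⟨hs.1, h⟩)
      refine ⟨fun j hj => (hl j hj).1, htr, fun hk => ?_⟩
      obtain ⟨-, -, h1, h2, -⟩ := hpv hk
      exact ⟨by linarith, by linarith⟩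
    · obtain ⟨-, hpv, hl, htr⟩ := (hPul s).1 (hPulAll s ⟨h, hs.2⟩)
      refine ⟨fun j hj => (hl j hj).1, htr, fun hk => ?_⟩
      obtain ⟨-, h1, h2, -⟩ := hpv hk
      exact ⟨by linarith, by linarith⟩
  rw [hInv]
  refine ⟨hbB', fun s hs => ?_, ⟨hy0, hy1, hmy, hM0x1.trans hM0x⟩, fun _ => ?_, ?_, fun j hj => ?_,
    fun j hj s hs => ?_, fun k hk0 hk => ?_⟩
  · -- the new level is a running maximum
    rcases le_total s t₀ with h | h
    · have h1 := hhist0 1 le_rfl s ⟨hs.1, h⟩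
      simp only [Nat.cast_one] at h1
      linarith
    rcases le_total s tι with h' | h'
    · obtain ⟨-, -, ⟨h1, -⟩, -⟩ := (hPre s).1 (hPreAll s ⟨h, h'⟩)
      have h2 := le_abs_self (bv (n + 1) s)
      linarith
    · exact hβmax s ⟨h', hs.2⟩
  · -- the old front pair
    rw [show n + 1 - 1 = n by ring]
    exact ⟨hwn0, hwn1, hwn2, hbn1, hbn2, hM0n.trans (by nlinarith), hM1n⟩
  · -- level one of the new front = old level two
    have h := hlad1 2 le_rfl
    rw [show n + 1 + 1 = n + ((2 : ℕ) : ℤ) by push_cast; ring]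
    rw [hlad2] at h
    exact ⟨h.1, h.2.1.trans (by linarith), h.2.2.1, h.2.2.2⟩
  · -- the ladder, shifted by one rung
    obtain ⟨h1, h2, h3, h4⟩ := hlad1 (j + 1) (by omega)
    rw [show n + 1 + (j : ℤ) = n + ((j + 1 : ℕ) : ℤ) by push_cast; ring]
    have hm := hladm j
    exact ⟨h1.trans hm, h2.trans (by linarith), h3.trans hm, h4.trans hm⟩
  · -- the histories of the levels above the new front
    rw [show n + 1 + (j : ℤ) = n + ((j + 1 : ℕ) : ℤ) by push_cast; ring]
    rcases le_total s t₀ with h | h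
    · exact hhist0 (j + 1) (by omega) s ⟨hs.1, h⟩
    · have h1 := (hbox s ⟨h, hs.2⟩).1 (j + 1) (by omega)
      have h2 := le_abs_self (bv (n + ((j + 1 : ℕ) : ℤ)) s)
      have h3 := (hlad0 (j + 1)).2
      linarith
  · -- the trail of the new front
    rcases lt_or_eq_of_le (show k ≤ n - 1 by omega) with hk2 | hk1
    · -- an old trail mode: same entry record, extended running bounds
      have hk2' : k ≤ n - 2 := by omega
      obtain ⟨te, hte, hentry, hrun⟩ := htrail0 k hk0 hk2'
      refine ⟨te, ⟨hte.1, hte.2.trans ht₀1⟩, hentry, fun s hs => ?_⟩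
      rcases le_total s t₀ with h | h
      · exact hrun s ⟨hs.1, h⟩
      · obtain ⟨-, htr, hpv⟩ := hbox s ⟨h, hs.2⟩
        have hsT : s ∈ Icc 0 T := ⟨ht₀.trans h, hs.2.trans ht₁T⟩
        obtain ⟨h1, h2, h3, h4, h5⟩ := htr k hk0 hk2'
        refine ⟨h1, h2, h3, h4, h5, ?_, ?_⟩
        · rcases lt_or_ge (k - 1) n₀ with hlt | hge
          · rw [(hvan (k - 1) hlt s hsT).2.1, abs_zero]; norm_num
          · exact (htr (k - 1) hge (by omega)).2.2.1
        · rcases lt_or_ge (k + 1) (n - 1) with hlt | hge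
          · obtain ⟨h6, h7, -⟩ := htr (k + 1) (by omega) (by omega)
            exact ⟨by linarith, by linarith⟩
          · rw [show k + 1 = n - 1 by omega]
            exact hpv (by omega)
    · -- the spent previous pair enters the trail at t₁
      subst hk1
      obtain ⟨h1, h2, h3, h4, h5, -⟩ := hprev1 hk0
      have ht₁T' : t₁ ∈ Icc 0 T := ⟨ht₀.trans ht₀1, ht₁T⟩
      refine ⟨t₁, ⟨ht₀.trans ht₀1, le_rfl⟩, ⟨h2, h3, h1, by linarith, by linarith⟩, fun s hs => ?_⟩
      rw [handoff_mem_Icc_self hs, show n - 1 + 1 = n by ring, show n - 1 - 1 = n - 2 by ring]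
      refine ⟨by linarith, by linarith, h1.trans (by norm_num), by linarith, by linarith, ?_,
        by linarith, by linarith⟩
      rcases lt_or_ge (n - 2) n₀ with hlt | hge
      · rw [(hvan (n - 2) hlt t₁ ht₁T').2.1, abs_zero]; norm_num
      · exact (htrail1 (n - 2) hge le_rfl).2.2.1

/-- **A strict first crossing.** Let `g` be continuous on `[0, T]` with the continuous derivative
`dg` on `(0, T)`, `g < 1` on `[t₀, t_ι]` and `g(t₁) > 1` (`0 ≤ t₀ < t_ι < t₁ < T`). If at every first
passage time `t_c ∈ (t_ι, t₁)` of `g` through `1` the derivative is positive, then `g` crosses the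
level `1` strictly: first at some `t_c ∈ (t₀, t₁)`, staying `> 1` on a right neighbourhood
`(t_c, t_c + δ] ⊆ (t_c, t₁]`. [folklore] -/
theorem handoff_crossing {g dg : ℝ → ℝ} {t₀ tι t₁ T : ℝ} (ht₀ : 0 ≤ t₀) (ht₀ι : t₀ < tι)
    (hι1 : tι < t₁) (ht₁T : t₁ < T) (hg : ContinuousOn g (Icc 0 T)) (hdg : ContinuousOn dg (Icc 0 T))
    (hder : ∀ t ∈ Ioo 0 T, HasDerivAt g (dg t) t) (hpre : ∀ s ∈ Icc t₀ tι, g s < 1) (h1 : 1 < g t₁)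
    (hpos : ∀ tc ∈ Ioo tι t₁, g tc = 1 → (∀ s ∈ Ico tι tc, g s < 1) → 0 < dg tc) :
    ∃ tc ∈ Ioo t₀ t₁, (∀ s ∈ Ico t₀ tc, g s < 1) ∧ g tc = 1 ∧
      ∃ δ : ℝ, 0 < δ ∧ tc + δ ≤ t₁ ∧ ∀ s ∈ Ioc tc (tc + δ), 1 < g s := by
  have hgι : g tι < 1 := hpre tι ⟨ht₀ι.le, le_rfl⟩
  obtain ⟨tc, htc, hgc, hbefore⟩ := ivtNesting_exists_first_eq (f := g) hι1.le
    (hg.mono (Icc_subset_Icc (ht₀.trans ht₀ι.le) ht₁T.le)) hgι.le h1.le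
  have htcι : tι < tc := by
    rcases htc.1.eq_or_lt with h | h
    · rw [← h] at hgc; linarith
    · exact h
  have htc1 : tc < t₁ := by
    rcases htc.2.eq_or_lt with h | h
    · rw [h] at hgc; linarith
    · exact h
  have hdpos : 0 < dg tc := hpos tc ⟨htcι, htc1⟩ hgc hbefore
  -- a right neighbourhood where the derivative stays positive
  have htc0 : 0 < tc := lt_of_le_of_lt ht₀ (ht₀ι.trans htcι)
  have htcT : tc < T := htc1.trans ht₁T
  have hca : ContinuousAt dg tc := hdg.continuousAt (Icc_mem_nhds htc0 htcT)
  obtain ⟨ε, hε, hball⟩ := Metric.eventually_nhds_iff.1 (continuousAt_const.eventually_lt hca hdpos)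
  set δ := min (ε / 2) (t₁ - tc) with hδ
  have hδ0 : 0 < δ := lt_min (by linarith) (by linarith)
  have hδ1 : tc + δ ≤ t₁ := by have := min_le_right (ε / 2) (t₁ - tc); linarith
  have hδε : δ ≤ ε / 2 := min_le_left _ _
  have hmono : StrictMonoOn g (Icc tc (tc + δ)) := by
    refine strictMonoOn_of_deriv_pos (convex_Icc _ _)
      (hg.mono (Icc_subset_Icc htc0.le (by linarith))) fun x hx => ?_
    rw [interior_Icc] at hx
    rw [(hder x ⟨htc0.trans hx.1, by linarith [hx.2]⟩).deriv]
    refine hball ?_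
    rw [Real.dist_eq, abs_lt]
    exact ⟨by linarith [hx.1], by linarith [hx.2]⟩
  refine ⟨tc, ⟨ht₀ι.trans htcι, htc1⟩, fun s hs => ?_, hgc, δ, hδ0, hδ1, fun s hs => ?_⟩
  · rcases le_or_gt s tι with h | h
    · exact hpre s ⟨hs.1, h⟩
    · exact hbefore s ⟨h.le, hs.2⟩
  · have := hmono ⟨le_rfl, by linarith⟩ ⟨hs.1.le, hs.2⟩ hs.1
    rwa [hgc] at this

/-- **Before the crossing the old bond has not collapsed.** In the slow time of the pulse (forced gate
with `|f₂| ≤ 1/2000`, energy corridor `b + β ≥ B − 1/50 − 1.111 B σ` on the horizon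
`B σ_P = 5 log B + 20`, `B ≥ 10⁴`), as long as `β ≤ 1` and `w ≥ 1` the factor `b − β − 1` is positive,
so `w' ≥ −1/2000` and `w(σ_c) ≥ w(0) − σ_c/2000 ≥ √B/10 − 10⁻⁴ ≥ 9`. [folklore] -/
theorem handoff_w_lower {b w β f₂ : ℝ → ℝ} {B σP σc : ℝ} (hB : 10 ^ 4 ≤ B)
    (hσP : B * σP = 5 * Real.log B + 20) (hσP1 : σP ≤ 1 / 10) (hσc : σc ∈ Ioc 0 σP)
    (hwc : ContinuousOn w (Icc 0 σP))
    (hwd : ∀ σ ∈ Ioo 0 σP, HasDerivAt w (w σ * (b σ - β σ - 1) + f₂ σ) σ)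
    (hf : ∀ σ ∈ Icc 0 σP, |f₂ σ| ≤ 1 / 2000)
    (henv : ∀ σ ∈ Icc 0 σP, B - 1 / 50 - 1111 / 1000 * B * σ ≤ b σ + β σ)
    (hw1 : ∀ σ ∈ Icc 0 σc, 1 ≤ w σ) (hβ1 : ∀ σ ∈ Ico 0 σc, β σ ≤ 1)
    (hw0 : w 0 = Real.sqrt B / 10) : 9 ≤ w σc := by
  have hB0 : 0 ≤ B := le_trans (by norm_num) hB
  have hL := pulse_log_le hB
  have hsqrt : 100 ≤ Real.sqrt B := by
    rw [show (100 : ℝ) = Real.sqrt (10 ^ 4) by rw [show (10 : ℝ) ^ 4 = 100 ^ 2 by norm_num,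
      Real.sqrt_sq (by norm_num)]]
    exact Real.sqrt_le_sqrt hB
  have hmvt := pulse_image_sub_ge (f := w) (C := -(1 / 2000)) hσc.1.le
    (hwc.mono (Icc_subset_Icc_right hσc.2)) (fun x hx => by
      have hxP : x ∈ Icc 0 σP := ⟨hx.1.le, hx.2.le.trans hσc.2⟩
      refine ⟨_, hwd x ⟨hx.1, hx.2.trans_le hσc.2⟩, ?_⟩
      have hwx : 1 ≤ w x := hw1 x ⟨hx.1.le, hx.2.le⟩
      have hβx : β x ≤ 1 := hβ1 x ⟨hx.1.le, hx.2⟩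
      have he := henv x hxP
      have hBx : B * x ≤ 5 * Real.log B + 20 := by
        rw [← hσP]; exact mul_le_mul_of_nonneg_left hxP.2 hB0
      have hgap : 0 ≤ b x - β x - 1 := by nlinarith
      have hprod : 0 ≤ w x * (b x - β x - 1) := mul_nonneg (by linarith) hgap
      have hfx := (abs_le.1 (hf x hxP)).1
      linarith)
  rw [hw0] at hmvt
  have hσc1 : σc ≤ 1 / 10 := hσc.2.trans hσP1
  nlinarith

end Summit.NavierStokesRegularity.NavierStokesRegularity.Theorems.PerpetualPumpAveragedTypeIBlowup

end
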